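import Summits.CriticalPhenomena.PercolationContinuityZ3.Theorems.PercNearOneGluingNoHeavyQuantFarSunSharpLargeK
import HarnessLib

/-!
# FAR beyond trees: LAYERS 4 AND 5 OF FAR ON ALL HAIRY CYCLES WITH `K ≥ 102` / `K ≥ 112` HAIRS — the layer-`4` and layer-`5` instances of the sharp
# LEMMA 1 (`HairyCycle.sunFAR_four_of_ge : 102 ≤ K → SunFAR K 4`, `HairyCycle.sunFAR_five_of_ge : 112 ≤ K → SunFAR K 5`; uniform theorem: 136 / 153)

builds on p205010 (kernel theorem, internal audit signed; external expert review pending)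

Support file (`--supports stmt-CriticalPhenomena-4575`), seat `prim-cert-1` (gen 42); memo `prim-cert-1/FROM-prim-cert-1-g42-SHARP-LARGEK.md` §2.
`HairyCycle.witGavg_ge_one_sharp` (…QuantFarSunSharpWitAvg) with tuned constants, then LEMMA 2 (`jKF_lt_of_R`, `hairV_univ_ge_chernoff`) as in …QuantFarSunSharpLayerThree:
* layer 4: `M = 11/2`, `θ₂ = 1/2`, `ρ = 9/20`, `θ₁ = 2/5` — `Σ_{k<K} h k ≥ 89/4 ⟹ witGavg K h 4 ≥ 1` (`witGavg_ge_one_four`) and **`sunFAR_four_of_ge`** (`K ≥ 102`);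
* layer 5: `M = 13/2`, `θ₂ = 2/3`, `ρ = 2/5`, `θ₁ = 2/5` — `Σ_{k<K} h k ≥ 105/4 ⟹ witGavg K h 5 ≥ 1` (`witGavg_ge_one_five`) and **`sunFAR_five_of_ge`** (`K ≥ 112`).
So FAR on hairy cycles is open for `12 ≤ K ≤ 101` at layer 4 and `12 ≤ K ≤ 111` at layer 5.  No definitions, no sorries, standard axioms.  [this work]
[cite: KozmaNitzan2024, Conjecture 3 (p. 15)] (context: the lower-tail family FAR serves).
-/

noncomputable section

namespace Summit.CriticalPhenomena.PercolationContinuityZ3.Theorems.HairyCycle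

open Finset
open scoped Classical

variable {K : ℕ}

/-! ## Numeric lemmas -/

/-- `e^{51/4} ≥ 300000`. [folklore] -/
theorem exp_fiftyone_quarters_ge : (300000 : ℝ) ≤ Real.exp (51 / 4) := by
  have h1 := Real.exp_one_gt_d9
  have h2 := exp_three_quarters_ge
  have e : Real.exp (51 / 4) = Real.exp 1 ^ 12 * Real.exp (3 / 4) := by
    rw [← Real.exp_nat_mul, ← Real.exp_add]; norm_num
  rw [e]
  have h3 : (2.7182818283 : ℝ) ^ 12 ≤ Real.exp 1 ^ 12 := pow_le_pow_left₀ (by norm_num) h1.le 12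
  have h4 : (162000 : ℝ) ≤ (2.7182818283 : ℝ) ^ 12 := by norm_num
  have h5 : (0 : ℝ) ≤ Real.exp (3 / 4) := (Real.exp_pos _).le
  nlinarith

/-- `e^{15} ≥ 3200000`. [folklore] -/
theorem exp_fifteen_ge : (3200000 : ℝ) ≤ Real.exp 15 := by
  have h1 := Real.exp_one_gt_d9
  have e : Real.exp 15 = Real.exp 1 ^ 15 := by rw [← Real.exp_nat_mul]; norm_num
  rw [e]
  have h3 : (2.7182818283 : ℝ) ^ 15 ≤ Real.exp 1 ^ 15 := pow_le_pow_left₀ (by norm_num) h1.le 15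
  have h4 : (3200000 : ℝ) ≤ (2.7182818283 : ℝ) ^ 15 := by norm_num
  linarith

/-- `1024·e^{−14} ≤ 1/1000`. [folklore] -/
theorem exp_neg_fourteen_le : (1024 : ℝ) * Real.exp (-14) ≤ 1 / 1000 := by
  have h1 := Real.exp_one_gt_d9
  have e : Real.exp 14 = Real.exp 1 ^ 14 := by rw [← Real.exp_nat_mul]; norm_num
  have h3 : (2.7182818283 : ℝ) ^ 14 ≤ Real.exp 1 ^ 14 := pow_le_pow_left₀ (by norm_num) h1.le 14
  have h4 : (1200000 : ℝ) ≤ (2.7182818283 : ℝ) ^ 14 := by norm_num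
  have h6 : (1200000 : ℝ) ≤ Real.exp 14 := by rw [e]; linarith
  have hpos : 0 < Real.exp 14 := Real.exp_pos _
  rw [Real.exp_neg, ← div_eq_mul_inv, div_le_iff₀ hpos]
  linarith

/-- The flank reliability at layer `4`: `9/20 ≤ 1 − e^{−(1−1/2)·(11/2)}/(1/2)^{4−1} = 1 − 8e^{−11/4}`. [this work] -/
theorem rho_four_le : (9 / 20 : ℝ) ≤ 1 - Real.exp (-(1 - 1 / 2) * (11 / 2)) / (1 / 2 : ℝ) ^ (4 - 1) := by
  have h1 := Real.exp_one_gt_d9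
  have h2 := exp_three_quarters_ge
  have e : Real.exp (11 / 4) = Real.exp 1 ^ 2 * Real.exp (3 / 4) := by
    rw [← Real.exp_nat_mul, ← Real.exp_add]; norm_num
  have h3 : (2.7182818283 : ℝ) ^ 2 ≤ Real.exp 1 ^ 2 := pow_le_pow_left₀ (by norm_num) h1.le 2
  have h5 : (0 : ℝ) ≤ Real.exp (3 / 4) := (Real.exp_pos _).le
  have h6 : (14.7 : ℝ) ≤ Real.exp (11 / 4) := by rw [e]; nlinarith
  have hpos : 0 < Real.exp (11 / 4) := Real.exp_pos _
  rw [show -(1 - 1 / 2 : ℝ) * (11 / 2) = -(11 / 4) by norm_num, Real.exp_neg]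
  norm_num
  have hinv : (Real.exp (11 / 4))⁻¹ ≤ 1 / 14.7 := by
    rw [inv_eq_one_div, div_le_div_iff₀ hpos (by norm_num)]; linarith
  have e8 : (Real.exp (11 / 4))⁻¹ / (1 / 8) = 8 * (Real.exp (11 / 4))⁻¹ := by ring
  rw [e8]
  linarith

/-- The flank reliability at layer `5`: `2/5 ≤ 1 − e^{−(1−2/3)·(13/2)}/(2/3)^{5−1} = 1 − (81/16)e^{−13/6}`. [this work] -/
theorem rho_five_le : (2 / 5 : ℝ) ≤ 1 - Real.exp (-(1 - 2 / 3) * (13 / 2)) / (2 / 3 : ℝ) ^ (5 - 1) := by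
  have h1 := Real.exp_one_gt_d9
  have h2 := Real.quadratic_le_exp_of_nonneg (show (0 : ℝ) ≤ 1 / 6 by norm_num)
  have e : Real.exp (13 / 6) = Real.exp 1 ^ 2 * Real.exp (1 / 6) := by
    rw [← Real.exp_nat_mul, ← Real.exp_add]; norm_num
  have h3 : (2.7182818283 : ℝ) ^ 2 ≤ Real.exp 1 ^ 2 := pow_le_pow_left₀ (by norm_num) h1.le 2
  have h5 : (0 : ℝ) ≤ Real.exp (1 / 6) := (Real.exp_pos _).le
  have h6 : (8.7 : ℝ) ≤ Real.exp (13 / 6) := by rw [e]; nlinarith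
  have hpos : 0 < Real.exp (13 / 6) := Real.exp_pos _
  rw [show -(1 - 2 / 3 : ℝ) * (13 / 2) = -(13 / 6) by norm_num, Real.exp_neg]
  norm_num
  have hinv : (Real.exp (13 / 6))⁻¹ ≤ 1 / 8.7 := by
    rw [inv_eq_one_div, div_le_div_iff₀ hpos (by norm_num)]; linarith
  have e8 : (Real.exp (13 / 6))⁻¹ / (16 / 81) = 81 / 16 * (Real.exp (13 / 6))⁻¹ := by ring
  rw [e8]
  linarith

/-- **Numeric core of LEMMA 1 at layer 4**: for `S ≥ 89/4`,
`e^{−(1 − 2/5)(S−1)}/(2/5)^8 · (S − 7·(9/20)) ≤ (S − 11 − 2 − 8)·(9/20)³`. [this work] -/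
theorem sharp_numeric_four {S : ℝ} (hS : (89 / 4 : ℝ) ≤ S) :
    Real.exp (-(1 - 2 / 5) * (S - 1)) / (2 / 5 : ℝ) ^ (2 * 4) * (S - (2 * ((4 : ℕ) : ℝ) - 1) * (9 / 20)) ≤
      (S - 2 * (11 / 2) - 2 - 2 * ((4 : ℕ) : ℝ)) * (9 / 20 : ℝ) ^ 3 := by
  set u := S - 89 / 4 with hu
  have hu0 : 0 ≤ u := by rw [hu]; linarith
  have hE : (300000 : ℝ) * (1 + 3 * u / 5) ≤ Real.exp ((1 - 2 / 5) * (S - 1)) := by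
    have e : (1 - 2 / 5 : ℝ) * (S - 1) = 51 / 4 + 3 * u / 5 := by rw [hu]; ring
    rw [e, Real.exp_add]
    have h3 : 1 + 3 * u / 5 ≤ Real.exp (3 * u / 5) := by linarith [Real.add_one_le_exp (3 * u / 5)]
    exact mul_le_mul exp_fiftyone_quarters_ge h3 (by linarith) (Real.exp_pos _).le
  have hEpos : 0 < Real.exp ((1 - 2 / 5) * (S - 1)) := Real.exp_pos _
  have e2 : Real.exp (-(1 - 2 / 5) * (S - 1)) = 1 / Real.exp ((1 - 2 / 5) * (S - 1)) := by
    rw [show -(1 - 2 / 5 : ℝ) * (S - 1) = -((1 - 2 / 5) * (S - 1)) by ring, Real.exp_neg, inv_eq_one_div]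
  rw [e2]
  rw [show (1 : ℝ) / Real.exp ((1 - 2 / 5) * (S - 1)) / (2 / 5 : ℝ) ^ (2 * 4) * (S - (2 * ((4 : ℕ) : ℝ) - 1) * (9 / 20)) =
      (S - (2 * ((4 : ℕ) : ℝ) - 1) * (9 / 20)) / (2 / 5 : ℝ) ^ (2 * 4) / Real.exp ((1 - 2 / 5) * (S - 1)) by
    field_simp]
  rw [div_le_iff₀ hEpos]
  have hS' : S = 89 / 4 + u := by rw [hu]; ring
  have hrhs0 : (0 : ℝ) ≤ (S - 2 * (11 / 2) - 2 - 2 * ((4 : ℕ) : ℝ)) * (9 / 20 : ℝ) ^ 3 := by rw [hS']; push_cast; nlinarith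
  calc (S - (2 * ((4 : ℕ) : ℝ) - 1) * (9 / 20)) / (2 / 5 : ℝ) ^ (2 * 4)
      ≤ (S - 2 * (11 / 2) - 2 - 2 * ((4 : ℕ) : ℝ)) * (9 / 20 : ℝ) ^ 3 * ((300000 : ℝ) * (1 + 3 * u / 5)) := by
        rw [hS']; push_cast; norm_num
        nlinarith [hu0, mul_nonneg hu0 hu0]
    _ ≤ (S - 2 * (11 / 2) - 2 - 2 * ((4 : ℕ) : ℝ)) * (9 / 20 : ℝ) ^ 3 * Real.exp ((1 - 2 / 5) * (S - 1)) :=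
        mul_le_mul_of_nonneg_left hE hrhs0

/-- **Numeric core of LEMMA 1 at layer 5**: for `S ≥ 105/4`,
`e^{−(1 − 2/5)(S−1)}/(2/5)^10 · (S − 9·(2/5)) ≤ (S − 13 − 2 − 10)·(2/5)³`. [this work] -/
theorem sharp_numeric_five {S : ℝ} (hS : (105 / 4 : ℝ) ≤ S) :
    Real.exp (-(1 - 2 / 5) * (S - 1)) / (2 / 5 : ℝ) ^ (2 * 5) * (S - (2 * ((5 : ℕ) : ℝ) - 1) * (2 / 5)) ≤
      (S - 2 * (13 / 2) - 2 - 2 * ((5 : ℕ) : ℝ)) * (2 / 5 : ℝ) ^ 3 := by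
  set u := S - 105 / 4 with hu
  have hu0 : 0 ≤ u := by rw [hu]; linarith
  have hE : (3200000 : ℝ) * (1 + 3 * u / 5) ≤ Real.exp ((1 - 2 / 5) * (S - 1)) := by
    have e : (1 - 2 / 5 : ℝ) * (S - 1) = 15 + (3 / 20 + 3 * u / 5) := by rw [hu]; ring
    rw [e, Real.exp_add]
    have h3 : 1 + 3 * u / 5 ≤ Real.exp (3 / 20 + 3 * u / 5) := by linarith [Real.add_one_le_exp (3 / 20 + 3 * u / 5)]
    exact mul_le_mul exp_fifteen_ge h3 (by linarith) (Real.exp_pos _).le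
  have hEpos : 0 < Real.exp ((1 - 2 / 5) * (S - 1)) := Real.exp_pos _
  have e2 : Real.exp (-(1 - 2 / 5) * (S - 1)) = 1 / Real.exp ((1 - 2 / 5) * (S - 1)) := by
    rw [show -(1 - 2 / 5 : ℝ) * (S - 1) = -((1 - 2 / 5) * (S - 1)) by ring, Real.exp_neg, inv_eq_one_div]
  rw [e2]
  rw [show (1 : ℝ) / Real.exp ((1 - 2 / 5) * (S - 1)) / (2 / 5 : ℝ) ^ (2 * 5) * (S - (2 * ((5 : ℕ) : ℝ) - 1) * (2 / 5)) =
      (S - (2 * ((5 : ℕ) : ℝ) - 1) * (2 / 5)) / (2 / 5 : ℝ) ^ (2 * 5) / Real.exp ((1 - 2 / 5) * (S - 1)) by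
    field_simp]
  rw [div_le_iff₀ hEpos]
  have hS' : S = 105 / 4 + u := by rw [hu]; ring
  have hrhs0 : (0 : ℝ) ≤ (S - 2 * (13 / 2) - 2 - 2 * ((5 : ℕ) : ℝ)) * (2 / 5 : ℝ) ^ 3 := by rw [hS']; push_cast; nlinarith
  calc (S - (2 * ((5 : ℕ) : ℝ) - 1) * (2 / 5)) / (2 / 5 : ℝ) ^ (2 * 5)
      ≤ (S - 2 * (13 / 2) - 2 - 2 * ((5 : ℕ) : ℝ)) * (2 / 5 : ℝ) ^ 3 * ((3200000 : ℝ) * (1 + 3 * u / 5)) := by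
        rw [hS']; push_cast; norm_num
        nlinarith [hu0, mul_nonneg hu0 hu0]
    _ ≤ (S - 2 * (13 / 2) - 2 - 2 * ((5 : ℕ) : ℝ)) * (2 / 5 : ℝ) ^ 3 * Real.exp ((1 - 2 / 5) * (S - 1)) :=
        mul_le_mul_of_nonneg_left hE hrhs0

/-! ## LEMMA 1 at layers 4 and 5 -/

/-- **LEMMA 1 at layer 4.**  If `0 < h k ≤ 1` for `k < K` and `Σ_{k<K} h k ≥ 89/4`, then `witGavg K h 4 ≥ 1` (every `K`). [this work] -/
theorem witGavg_ge_one_four {h : ℕ → ℝ} (hh : ∀ k, k < K → 0 < h k ∧ h k ≤ 1) (hS : (89 / 4 : ℝ) ≤ ∑ k ∈ range K, h k) :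
    1 ≤ witGavg K h 4 := by
  refine witGavg_ge_one_sharp hh (j := 4) (by norm_num) (M := 11 / 2) (θ₁ := 2 / 5) (θ₂ := 1 / 2) (ρ := 9 / 20)
    (by norm_num) (by norm_num) (by norm_num) (by norm_num) (by norm_num) (by norm_num) rho_four_le ?_ ?_
  · push_cast; linarith
  · exact sharp_numeric_four hS

/-- **LEMMA 1 at layer 5.**  If `0 < h k ≤ 1` for `k < K` and `Σ_{k<K} h k ≥ 105/4`, then `witGavg K h 5 ≥ 1` (every `K`). [this work] -/
theorem witGavg_ge_one_five {h : ℕ → ℝ} (hh : ∀ k, k < K → 0 < h k ∧ h k ≤ 1) (hS : (105 / 4 : ℝ) ≤ ∑ k ∈ range K, h k) :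
    1 ≤ witGavg K h 5 := by
  refine witGavg_ge_one_sharp hh (j := 5) (by norm_num) (M := 13 / 2) (θ₁ := 2 / 5) (θ₂ := 2 / 3) (ρ := 2 / 5)
    (by norm_num) (by norm_num) (by norm_num) (by norm_num) (by norm_num) (by norm_num) rho_five_le ?_ ?_
  · push_cast; linarith
  · exact sharp_numeric_five hS

/-! ## The theorems -/

/-- **LAYER 4 OF FAR ON ALL HAIRY CYCLES WITH `K ≥ 102` HAIRS**: `SunFAR K 4` for every `K ≥ 102`. [this work] -/
theorem sunFAR_four_of_ge {K : ℕ} (hK : 102 ≤ K) : SunFAR K 4 := by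
  have hK2 : 2 ≤ K := by omega
  refine sunFAR_of_witGavg_from_all (j := 4) (by norm_num) K hK2 (fun K' hK' h hh m hm hmin hS2j hR => ?_) K le_rfl
  set h' : ℕ → ℝ := fun k => if k < K' then h k else 0 with hh'def
  have he : ∀ k, k < K' → h' k = h k := fun k hk => by rw [hh'def]; simp only [hk, if_true]
  have hh' : ∀ k, 0 ≤ h' k ∧ h' k ≤ 1 := by
    intro k
    by_cases hk : k < K'
    · rw [he k hk]; exact hh k hk
    · rw [hh'def]; simp only [hk, if_false]; norm_num
  have hsum : ∑ k ∈ range K', h' k = ∑ k ∈ range K', h k :=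
    Finset.sum_congr rfl fun k hk => he k (Finset.mem_range.1 hk)
  have hF : hairV K' h' 4 (range K') = hairV K' h 4 (range K') := hairV_congr he 4 (range K')
  have hL2 := jKF_lt_of_R (K := K') hh' (j := 4) (by norm_num) hm (fun k hk => by rw [he m hm, he k hk]; exact hmin k hk)
    (by rw [hsum]; exact hS2j) (by rw [hsum, hF, he m hm]; exact hR)
  rw [hsum, hF, he m hm] at hL2
  obtain ⟨hjKF, hjK, hηpos⟩ := hL2
  push_cast at hjKF hjK
  set S := ∑ k ∈ range K', h k with hSdef
  set F := hairV K' h 4 (range K') with hFdef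
  have hS0 : 0 ≤ S := Finset.sum_nonneg fun k hk => (hh k (Finset.mem_range.1 hk)).1
  have hK'r : (102 : ℝ) ≤ K' := by exact_mod_cast hK.trans hK'
  have hhpos : ∀ k, k < K' → 0 < h k ∧ h k ≤ 1 := fun k hk => ⟨lt_of_lt_of_le hηpos (hmin k hk), (hh k hk).2⟩
  have hSig : (89 / 4 : ℝ) ≤ S := by
    by_contra hlt
    push Not at hlt
    rcases le_or_gt S 19 with hS1 | hS1
    · have h1 : S * (S + 1) ≤ 19 * 20 := by nlinarith
      nlinarith
    · have hF1 := hairV_univ_ge_chernoff hh 4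
      rw [← hSdef, ← hFdef] at hF1
      have hexp : (4 : ℝ) ^ 4 * Real.exp (-(3 / 4) * S) ≤ 1 / 1000 := by
        refine le_trans ?_ exp_neg_fourteen_le
        rw [show (4 : ℝ) ^ 4 = 256 by norm_num]
        have h1 : Real.exp (-(3 / 4) * S) ≤ Real.exp (-14) := Real.exp_le_exp.2 (by linarith)
        linarith [Real.exp_pos (-(3 / 4) * S), Real.exp_pos (-14 : ℝ)]
      have hF999 : (999 / 1000 : ℝ) ≤ F := by linarith
      have hK'0 : (0 : ℝ) ≤ 4 * (K' : ℝ) := by positivity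
      have h1 : 4 * (K' : ℝ) * (999 / 1000) ≤ 4 * (K' : ℝ) * F := mul_le_mul_of_nonneg_left hF999 hK'0
      have h2 : S * (S - 4) < (89 / 4) * (73 / 4) := by nlinarith
      nlinarith
  exact witGavg_ge_one_four hhpos hSig

/-- **LAYER 5 OF FAR ON ALL HAIRY CYCLES WITH `K ≥ 112` HAIRS**: `SunFAR K 5` for every `K ≥ 112`. [this work] -/
theorem sunFAR_five_of_ge {K : ℕ} (hK : 112 ≤ K) : SunFAR K 5 := by
  have hK2 : 2 ≤ K := by omega
  refine sunFAR_of_witGavg_from_all (j := 5) (by norm_num) K hK2 (fun K' hK' h hh m hm hmin hS2j hR => ?_) K le_rfl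
  set h' : ℕ → ℝ := fun k => if k < K' then h k else 0 with hh'def
  have he : ∀ k, k < K' → h' k = h k := fun k hk => by rw [hh'def]; simp only [hk, if_true]
  have hh' : ∀ k, 0 ≤ h' k ∧ h' k ≤ 1 := by
    intro k
    by_cases hk : k < K'
    · rw [he k hk]; exact hh k hk
    · rw [hh'def]; simp only [hk, if_false]; norm_num
  have hsum : ∑ k ∈ range K', h' k = ∑ k ∈ range K', h k :=
    Finset.sum_congr rfl fun k hk => he k (Finset.mem_range.1 hk)
  have hF : hairV K' h' 5 (range K') = hairV K' h 5 (range K') := hairV_congr he 5 (range K')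
  have hL2 := jKF_lt_of_R (K := K') hh' (j := 5) (by norm_num) hm (fun k hk => by rw [he m hm, he k hk]; exact hmin k hk)
    (by rw [hsum]; exact hS2j) (by rw [hsum, hF, he m hm]; exact hR)
  rw [hsum, hF, he m hm] at hL2
  obtain ⟨hjKF, hjK, hηpos⟩ := hL2
  push_cast at hjKF hjK
  set S := ∑ k ∈ range K', h k with hSdef
  set F := hairV K' h 5 (range K') with hFdef
  have hS0 : 0 ≤ S := Finset.sum_nonneg fun k hk => (hh k (Finset.mem_range.1 hk)).1
  have hK'r : (112 : ℝ) ≤ K' := by exact_mod_cast hK.trans hK'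
  have hhpos : ∀ k, k < K' → 0 < h k ∧ h k ≤ 1 := fun k hk => ⟨lt_of_lt_of_le hηpos (hmin k hk), (hh k hk).2⟩
  have hSig : (105 / 4 : ℝ) ≤ S := by
    by_contra hlt
    push Not at hlt
    rcases le_or_gt S 23 with hS1 | hS1
    · have h1 : S * (S + 1) ≤ 23 * 24 := by nlinarith
      nlinarith
    · have hF1 := hairV_univ_ge_chernoff hh 5
      rw [← hSdef, ← hFdef] at hF1
      have hexp : (4 : ℝ) ^ 5 * Real.exp (-(3 / 4) * S) ≤ 1 / 1000 := by
        refine le_trans ?_ exp_neg_fourteen_le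
        rw [show (4 : ℝ) ^ 5 = 1024 by norm_num]
        exact mul_le_mul_of_nonneg_left (Real.exp_le_exp.2 (by linarith)) (by norm_num)
      have hF999 : (999 / 1000 : ℝ) ≤ F := by linarith
      have hK'0 : (0 : ℝ) ≤ 5 * (K' : ℝ) := by positivity
      have h1 : 5 * (K' : ℝ) * (999 / 1000) ≤ 5 * (K' : ℝ) * F := mul_le_mul_of_nonneg_left hF999 hK'0
      have h2 : S * (S - 5) < (105 / 4) * (85 / 4) := by nlinarith
      nlinarith
  exact witGavg_ge_one_five hhpos hSig

end Summit.CriticalPhenomena.PercolationContinuityZ3.Theorems.HairyCycle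

end
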